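/-
Origin: expansion seat `planner-pub-hodgecm-pv11-0`, handover 2026-08-18 (`HOME/pub-hodgecm-pv11/lean/Pv11/SupplyDictionary.lean`, md5 3210be56, 127 lines);
landed by the gen-6 packager in gate run 22 as `HodgeCM/PerL34/SupplyDictionary.lean` (import ^import Pv[0-9]+\.→import HodgeCM.PerL34. ×1).
-/
import Summits.HodgeConjecture.HodgeCM.PerL34.SupplyElementary_2
import Summits.HodgeConjecture.HodgeCM.Automorphic.ThetaWedgeSplit

/-!
# Route (E) — BY-NAME bridge from the elementary supply kernel to `ThetaModel.Open_supply`

`SupplyElementary.lean` kernel-proves (E1)–(E4): over the lattice/theta shell, the family `φ_N = φ_∞ ⊗ 1_{x₀+N𝔏}`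
has, for some `N`, a NONZERO theta lift `θ(φ_N, χ′)(g₀)` against a continuous unitary (automorphic) character `χ′`
of `[U(W_j)]` of the archimedean type forced by the weight of `φ_∞` (modulo the ONE PRINT hypothesis
`CharSeparating`, Einsiedler–Ward Thm 12.84).  Prover 1's open input `ThetaModel.Open_supply`
(`HodgeCM/Automorphic/ThetaWedgeSplit.lean`) asks, per good context, for a nonzero theta ONE-FORM of type `Ψ₀`
and one of type `Ψ₁`.  This file records the remaining passage as ONE named dictionary field per type and proves
`Open_supply` from a bridge record per good context — so that on the §10 (`S^all`) path the supply input is fed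
BY NAME: `open_supply_of_bridges`, then prl2-g2's `typeSupplyEach01_of_supply (hsub : Open_thetaSub)` (run 21).

## Labels of the fields of `SupplyBridge T V c k` (G-R2-14 vocabulary)

* SETUP (D4′): `DS` (the shell of `Seesaw.lean`), the compact abelian group / Borel / Haar data on
  `DS.A₁ = [U(W_j)]` (`ν` finite, full support, right-invariant: Haar), the archimedean torus `i : B →* DS.A₁`
  (`U(W_j)(L₀ ⊗ ℝ) → [U(W_j)]`) with the weight `w` of `φ_∞` (PerL l. 484, cross-reference), the lattice `Λ` with
  size `ℓ` and `F v = φ_∞(x₀ + v)` absolutely summable with `F 0 = φ_∞(x₀) ≠ 0` (a Schwartz function nonzero at a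
  rational point — density of `V(L₀)` in `V(L₀ ⊗ ℝ)`, DEFINITIONAL).
* PRINT: `sep : CharSeparating DS.A₁` (Einsiedler–Ward GTM 276 Thm 12.84, quoted in `SupplyElementary`).
* DICTIONARY (INTERNAL-DEFINITIONAL, D4/D5): `hval` (`θ_{φ_N}(g₀,u₀) = Σ_v F (N • v)`: Schrödinger model at the
  base point + `supp 1_{x₀+N𝔏} ∩ V(L₀) = x₀ + NΛ`), `hcont` (continuity of `u ↦ θ_φ(g₀,u)` on `[U(W_j)]`, PerL
  l. 335), `heq` (the `U(W_j)(ℝ)`-weight of `φ_∞`).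
* RESIDUAL, named, NOT kernel here — exactly the part route (E) does not make elementary (LEMMAS v5 §10 clause (β),
  carverg2-X2; prl2 (A1)+(D)): `form_of_lift` = "a nonzero theta lift `θ(φ_N,χ′)` with `χ′_∞` of the forced type
  yields a nonzero theta one-form `u_f ∈ Θ_k(Γ)` at some level" (D1/D5 realisation `pr_{𝔭₊}` + the archimedean
  component `J⁺ ⊠ 1` of the constituents of the closure of `Θ(χ′)`: MVW/Rallis + Howe 1989 / KV78 / Li 1990 per
  the carver's (β); PerL Lemma 4.1(a),(b) is the cross-reference, NOT a source).

Nothing is cited as a fact; nothing is asserted; axioms = the standard trio.  Unit `pub-hodgecm-pv11`, 2026-08-18.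
-/

set_option autoImplicit false

noncomputable section

open MeasureTheory
open HodgeCM.PerL34.Seesaw
open HodgeCM.PerL34.SupplyElementary

namespace HodgeCM
namespace PerL34
namespace SupplyDictionary

variable {U : Universe} (T : U.ThetaModel)
variable {L : CMField} {ι₁ : L →+* ℂ} (V : HermSpace3 L ι₁) (c : SeesawCtx L) (k : Fin 4)

/-- **The route-(E) bridge record** for the theta one-forms of type index `k` (side `W_j`, modelled on the `₁`-side
of a lattice shell `DS`); see the module docstring for the label of every field. -/
structure SupplyBridge where
  /-- SETUP (D4′): the lattice shell -/
  DS : ThetaSeesawData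
  [instA : CommGroup DS.A₁]
  [instT : TopologicalSpace DS.A₁]
  [instTG : IsTopologicalGroup DS.A₁]
  [instC : CompactSpace DS.A₁]
  [instM : MeasurableSpace DS.A₁]
  [instB : BorelSpace DS.A₁]
  /-- SETUP: Haar measure of the compact group `[U(W_j)]` -/
  ν : Measure DS.A₁
  [instF : IsFiniteMeasure ν]
  [instO : ν.IsOpenPosMeasure]
  [instR : ν.IsMulRightInvariant]
  /-- PRINT (Einsiedler–Ward Thm 12.84): characters of `[U(W_j)]` separate points -/
  sep : CharSeparating DS.A₁
  /-- SETUP: the archimedean torus `U(W_j)(L₀ ⊗ ℝ)` and its map to `[U(W_j)]` -/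
  B : Type
  [instBM : Monoid B]
  i : B →* DS.A₁
  /-- SETUP: the weight of `φ_∞` under `U(W_j)(ℝ)` (tex l. 484) -/
  w : B → ℂ
  /-- SETUP: the lattice `Λ ⊂ V(L₀)` with an `ℕ`-valued size -/
  Λ : Type
  [instΛ : AddCommGroup Λ]
  ℓ : Λ → ℕ
  hℓ0 : ∀ v, ℓ v = 0 ↔ v = 0
  hℓ : ∀ (N : ℕ) (v : Λ), ℓ (N • v) = N * ℓ v
  /-- SETUP: `F v = φ_∞(x₀ + v)`, absolutely summable over `Λ`, `φ_∞(x₀) ≠ 0` -/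
  F : Λ → ℂ
  hF : Summable fun v => ‖F v‖
  hF0 : F 0 ≠ 0
  /-- DICTIONARY (D4): the family `φ_N = φ_∞ ⊗ 1_{x₀ + N𝔏}` and the base point -/
  φN : ℕ → DS.S₁
  g₀ : DS.G
  u₀ : DS.A₁
  hval : ∀ N : ℕ, DS.thetaKernel₁ (φN N) g₀ u₀ = ∑' v, F (N • v)
  /-- DICTIONARY (D5): continuity of the theta kernel on `[U(W_j)]` -/
  hcont : ∀ N : ℕ, Continuous fun u => DS.thetaKernel₁ (φN N) g₀ u
  /-- DICTIONARY (D5): `w`-equivariance of the theta kernel under the archimedean torus -/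
  heq : ∀ (N : ℕ) (u : DS.A₁) (t : B), DS.thetaKernel₁ (φN N) g₀ (u * i t) = w t * DS.thetaKernel₁ (φN N) g₀ u
  /-- RESIDUAL ((β) + D1/D5, named; NOT kernel in this package): a nonzero theta lift against a character of the
  forced archimedean type yields a nonzero theta one-form of type index `k` at some level -/
  form_of_lift : ∀ (N : ℕ) (χ : PontryaginDual DS.A₁), (∀ t : B, ((χ (i t) : Circle) : ℂ) * w t = 1) →
    DS.thetaLift₁ ν (fun u => ((χ u : Circle) : ℂ)) (φN N) g₀ ≠ 0 → ∃ Γ : Level V, ∃ ω ∈ T.Theta V c k Γ, ω ≠ 0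

attribute [instance] SupplyBridge.instA SupplyBridge.instT SupplyBridge.instTG SupplyBridge.instC
  SupplyBridge.instM SupplyBridge.instB SupplyBridge.instF SupplyBridge.instO SupplyBridge.instR
  SupplyBridge.instBM SupplyBridge.instΛ

variable {T V c k}

/-- **Supply of type index `k` from a bridge record**: KERNEL (E1)–(E4) + the one residual field. -/
theorem supply_of_bridge (Br : SupplyBridge T V c k) : ∃ Γ : Level V, ∃ ω ∈ T.Theta V c k Γ, ω ≠ 0 := by
  obtain ⟨N, χ, hne, htype⟩ := supply₁_of_lattice Br.DS Br.ν Br.sep Br.i Br.w Br.ℓ Br.hℓ0 Br.hℓ Br.F Br.hF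
    Br.hF0 Br.φN Br.g₀ Br.u₀ Br.hval Br.hcont Br.heq
  exact Br.form_of_lift N χ htype hne

variable (T) in
/-- **`Open_supply` BY NAME on the §10 path**: a route-(E) bridge record for each of the type indices `0, 1` in
every good context gives prover 1's `ThetaModel.Open_supply`; with `Open_thetaSub`, prl2-g2's
`typeSupplyEach01_of_supply` (run 21) then gives `(S₀₁ᵉ)`. -/
theorem open_supply_of_bridges
    (hB : ∀ {L : CMField} {ι₁ : L →+* ℂ} (V : HermSpace3 L ι₁) (c : SeesawCtx L), T.GoodCtx ι₁ c →
      Nonempty (SupplyBridge T V c 0) ∧ Nonempty (SupplyBridge T V c 1)) :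
    T.Open_supply := by
  intro L ι₁ V c hc
  obtain ⟨⟨B₀⟩, ⟨B₁⟩⟩ := hB V c hc
  exact ⟨supply_of_bridge B₀, supply_of_bridge B₁⟩

end SupplyDictionary
end PerL34
end HodgeCM

end
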